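import Literature.NumberTheory.LFunctions.WeilExplicitDirichletWeilForm
import Literature.NumberTheory.LFunctions.WeilMellinBounds
import Literature.Analysis.SpecialFunctions.FrullaniExp
import Mathlib.MeasureTheory.Measure.Lebesgue.Integral
import HarnessLib

/-!
# Weil's finite part `PF ∫ F(x) K_{1,a}(x) dx` for test functions: the limit exists, closed form

Sibling of `WeilExplicitDirichletWeilForm.lean`, which types Weil's «partie finie» (A. Weil, *Sur les
"formules explicites" de la théorie des nombres premiers*, Comm. Sém. Math. Univ. Lund 1952, p. 260)

  `PF ∫ α(x) dx = lim_{λ→+∞} [∫ (1 − e^{−λ|x|}) α(x) dx − 2β(0) log λ]`,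

for `α = F · K_{1,a}`, `K_{1,a}(x) = e^{(1/2−a)|x|}/|eˣ − e^{−x}|`, `2β(0) = F(0)`, as a `limUnder`
(`weilPFIntegralK1 a F`; junk if the limit does not exist).  Weil proves the existence of the limit
for his class (A), (B) (pp. 260–261).  This file PROVES it for smooth compactly supported `F = g`
(the tree's `IsWeilTest`) and identifies the value with an absolutely convergent integral:

  `PF ∫ g K_{1,a} = ∫_ℝ e^{−(a+1/2)|x|} ( g(x)/(1 − e^{−2|x|}) − g(0)/(2|x|) ) dx − g(0) log(a + 1/2)`

(`weilPFIntegralK1_eq`, `tendsto_weilPF`).  Proof: `K_{1,a}(x) = e^{−(a+1/2)|x|}/(1 − e^{−2|x|})`;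
subtract the counterterm `g(0) e^{−(a+1/2)|x|}/(2|x|)`, whose regularised integral is the exponential
Frullani integral `∫₀^∞ (e^{−βt} − e^{−(β+λ)t}) dt/t = log((β+λ)/β)` (the tree's
`Literature.Analysis.SpecialFunctions.integral_frullani_exp`), `β = a + 1/2`; the remainder is
`O(e^{−|x|/2})` uniformly (`g` Lipschitz at `0`, `1 − e^{−2u} ≥ (1 − e^{−2})u` on `[0,1]`,
`|e^{−2u} − 1 + 2u| ≤ 4u²` on `[0,1/2]`), so dominated convergence applies, and
`log((β+λ)/β) − log λ → −log β`.

## References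

* A. Weil, *Sur les "formules explicites" de la théorie des nombres premiers*, Comm. Sém. Math.
  Univ. Lund (1952), 252–265, p. 260 (definition of `PF`), p. 262 (`K_{1,f}`).
  [Weil1952FormulesExplicites]
-/

noncomputable section

open Complex Filter Set MeasureTheory Topology
open scoped Real ContDiff

namespace Literature.NumberTheory.LFunctions

namespace WeilPF

variable {g : ℝ → ℂ}

/-! ### The kernel `K_{1,a}(x) = e^{−(a+1/2)|x|}/(1 − e^{−2|x|})` -/

/-- `|eˣ − e^{−x}| = e^{|x|}(1 − e^{−2|x|})`. [folklore] -/
private theorem abs_exp_sub_exp_neg (x : ℝ) :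
    |Real.exp x - Real.exp (-x)| = Real.exp |x| * (1 - Real.exp (-(2 * |x|))) := by
  have key : ∀ y : ℝ, Real.exp y - Real.exp (-y) = Real.exp y * (1 - Real.exp (-(2 * y))) := by
    intro y
    rw [mul_sub, mul_one, ← Real.exp_add, show y + -(2 * y) = -y by ring]
  rcases le_total 0 x with hx | hx
  · rw [abs_of_nonneg hx, abs_of_nonneg (sub_nonneg.2 (Real.exp_le_exp.2 (by linarith))), key x]
  · rw [abs_of_nonpos hx, abs_of_nonpos (sub_nonpos.2 (Real.exp_le_exp.2 (by linarith))), neg_sub,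
      show Real.exp (-x) - Real.exp x = Real.exp (-x) - Real.exp (-(-x)) by rw [neg_neg], key (-x)]

/-- **`K_{1,a}(x) = e^{−(a+1/2)|x|}/(1 − e^{−2|x|})`** (both sides are `0` at `x = 0` by the
division convention). [cite: Weil1952FormulesExplicites, p. 262 (definition of K_{1,f})] -/
theorem weilKernelK1_eq (a : ℕ) (x : ℝ) :
    weilKernelK1 a x = Real.exp (-((a + 1 / 2) * |x|)) / (1 - Real.exp (-(2 * |x|))) := by
  have h : Real.exp ((1 / 2 - (a : ℝ)) * |x|) / Real.exp |x| = Real.exp (-((a + 1 / 2) * |x|)) := by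
    rw [← Real.exp_sub]; congr 1; ring
  unfold weilKernelK1
  rw [abs_exp_sub_exp_neg, ← div_div, h]

/-- `1 − e^{−2u} ≥ (1 − e^{−2}) u` for `0 ≤ u ≤ 1` (convexity of `exp`). [folklore] -/
private theorem one_sub_exp_ge {u : ℝ} (hu0 : 0 ≤ u) (hu1 : u ≤ 1) :
    (1 - Real.exp (-2)) * u ≤ 1 - Real.exp (-(2 * u)) := by
  have h := convexOn_exp.2 (mem_univ (0 : ℝ)) (mem_univ (-2 : ℝ)) (sub_nonneg.2 hu1) hu0
    (by ring : (1 - u) + u = 1)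
  simp only [smul_eq_mul, mul_zero, zero_add, Real.exp_zero, mul_one] at h
  rw [show u * -2 = -(2 * u) by ring] at h
  linarith

/-- `|1/(1 − e^{−2u}) − 1/(2u)| ≤ 2/(1 − e^{−2}) + 1/(1 − e^{−1}) + 1` for `u > 0`. [folklore] -/
private theorem abs_inv_sub_inv_le {u : ℝ} (hu : 0 < u) :
    |1 / (1 - Real.exp (-(2 * u))) - 1 / (2 * u)| ≤
      2 / (1 - Real.exp (-2)) + 1 / (1 - Real.exp (-1)) + 1 := by
  have hc1 : 0 < 1 - Real.exp (-2) := by linarith [Real.exp_lt_one_iff.2 (by norm_num : (-2 : ℝ) < 0)]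
  have hc2 : 0 < 1 - Real.exp (-1) := by linarith [Real.exp_lt_one_iff.2 (by norm_num : (-1 : ℝ) < 0)]
  have hD : 0 < 1 - Real.exp (-(2 * u)) := by
    linarith [Real.exp_lt_one_iff.2 (by linarith : -(2 * u) < 0)]
  have hA : 0 ≤ 2 / (1 - Real.exp (-2)) := by positivity
  have hB : 0 ≤ 1 / (1 - Real.exp (-1)) := by positivity
  rcases le_or_gt u (1 / 2) with h | h
  · -- `u ≤ 1/2`: second-order cancellation
    have hnum : |Real.exp (-(2 * u)) - 1 - -(2 * u)| ≤ (-(2 * u)) ^ 2 :=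
      Real.abs_exp_sub_one_sub_id_le (by rw [abs_neg, abs_of_nonneg (by linarith)]; linarith)
    have hden : (1 - Real.exp (-2)) * u ≤ 1 - Real.exp (-(2 * u)) := one_sub_exp_ge hu.le (by linarith)
    have e : 1 / (1 - Real.exp (-(2 * u))) - 1 / (2 * u) =
        (Real.exp (-(2 * u)) - 1 - -(2 * u)) / (2 * u * (1 - Real.exp (-(2 * u)))) := by
      field_simp
      ring
    rw [e, abs_div, abs_of_pos (by positivity : 0 < 2 * u * (1 - Real.exp (-(2 * u))))]
    have h1 : |Real.exp (-(2 * u)) - 1 - -(2 * u)| / (2 * u * (1 - Real.exp (-(2 * u)))) ≤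
        (2 * u) ^ 2 / (2 * u * ((1 - Real.exp (-2)) * u)) := by
      rw [show (-(2 * u)) ^ 2 = (2 * u) ^ 2 by ring] at hnum
      gcongr
    have h2 : (2 * u) ^ 2 / (2 * u * ((1 - Real.exp (-2)) * u)) = 2 / (1 - Real.exp (-2)) := by
      field_simp
    linarith [h1.trans_eq h2]
  · -- `u ≥ 1/2`: both terms are bounded
    have hD' : 1 - Real.exp (-1) ≤ 1 - Real.exp (-(2 * u)) := by
      linarith [Real.exp_le_exp.2 (by linarith : -(2 * u) ≤ -1)]
    have h1 : |1 / (1 - Real.exp (-(2 * u)))| ≤ 1 / (1 - Real.exp (-1)) := by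
      rw [abs_of_pos (by positivity)]
      exact one_div_le_one_div_of_le hc2 hD'
    have h2 : |1 / (2 * u)| ≤ 1 := by
      rw [abs_of_pos (by positivity), div_le_one (by positivity)]; linarith
    calc |1 / (1 - Real.exp (-(2 * u))) - 1 / (2 * u)|
        ≤ |1 / (1 - Real.exp (-(2 * u)))| + |1 / (2 * u)| := abs_sub _ _
      _ ≤ 2 / (1 - Real.exp (-2)) + 1 / (1 - Real.exp (-1)) + 1 := by linarith

/-! ### The regular part and its decay -/

/-- The regular part of Weil's `PF` integrand for parity `a` and a function `g`:
`R_a(g)(x) = e^{−(a+1/2)|x|} ( g(x)/(1 − e^{−2|x|}) − g(0)/(2|x|) )` (`= 0` at `x = 0`).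
[cite: Weil1952FormulesExplicites, p. 260 (PF) with p. 262 (K_{1,f})] -/
def weilPFRegular (a : ℕ) (g : ℝ → ℂ) (x : ℝ) : ℂ :=
  (Real.exp (-((a + 1 / 2) * |x|)) : ℂ) *
    (g x / ((1 - Real.exp (-(2 * |x|)) : ℝ) : ℂ) - g 0 / ((2 * |x| : ℝ) : ℂ))

/-- `R_a(g)(0) = 0`. [folklore] -/
private theorem weilPFRegular_zero (a : ℕ) (g : ℝ → ℂ) : weilPFRegular a g 0 = 0 := by
  simp [weilPFRegular]

/-- **Decay of the regular part**: `‖R_a(g)(x)‖ ≤ M e^{−|x|/2}` for a test function `g`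
(`g` is Lipschitz and bounded; `1 − e^{−2u} ≥ (1−e^{−2})u` on `[0,1]`; the second-order
cancellation `1/(1−e^{−2u}) − 1/(2u) = O(1)`; Weil p. 260: `β = |x|α` is again in the class (A),
here quantitatively for `C_c^∞`). [cite: Weil1952FormulesExplicites, p. 260 (PF: the regularised integrand)] -/
theorem exists_norm_weilPFRegular_le (hg : IsWeilTest g) (a : ℕ) :
    ∃ M : ℝ, 0 ≤ M ∧ ∀ x : ℝ, ‖weilPFRegular a g x‖ ≤ M * Real.exp (-(|x| / 2)) := by
  obtain ⟨G, hG⟩ := hg.1.continuous.bounded_above_of_compact_support hg.2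
  obtain ⟨L, hL⟩ := hg.deriv.1.continuous.bounded_above_of_compact_support hg.deriv.2
  have hG0 : 0 ≤ G := (norm_nonneg _).trans (hG 0)
  have hL0 : 0 ≤ L := (norm_nonneg _).trans (hL 0)
  set c₁ : ℝ := 1 - Real.exp (-2) with hc₁
  have hc1 : 0 < c₁ := by simp only [hc₁]; linarith [Real.exp_lt_one_iff.2 (by norm_num : (-2 : ℝ) < 0)]
  set H : ℝ := 2 / (1 - Real.exp (-2)) + 1 / (1 - Real.exp (-1)) + 1 with hH
  have hH0 : 0 ≤ H := by
    have hc2 : 0 < 1 - Real.exp (-1) := by linarith [Real.exp_lt_one_iff.2 (by norm_num : (-1 : ℝ) < 0)]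
    simp only [hH]; positivity
  -- Lipschitz bound at `0`
  have hlip : ∀ x : ℝ, ‖g x - g 0‖ ≤ L * |x| := by
    intro x
    have h := convex_univ.norm_image_sub_le_of_norm_deriv_le (f := g) (𝕜 := ℝ)
      (fun y _ ↦ hg.1.differentiable (by simp) y) (fun y _ ↦ hL y) (mem_univ 0) (mem_univ x)
    simpa using h
  refine ⟨(L + 2 * G) / c₁ + ‖g 0‖ * H, by positivity, fun x ↦ ?_⟩
  rcases eq_or_ne x 0 with rfl | hx
  · rw [weilPFRegular_zero]; simp only [norm_zero]; positivity
  have hu : 0 < |x| := abs_pos.2 hx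
  set u : ℝ := |x| with hu_def
  have hD : 0 < 1 - Real.exp (-(2 * u)) := by
    linarith [Real.exp_lt_one_iff.2 (by linarith : -(2 * u) < 0)]
  -- the bracket
  have hT1 : ‖(g x - g 0) / ((1 - Real.exp (-(2 * u)) : ℝ) : ℂ)‖ ≤ (L + 2 * G) / c₁ := by
    rw [norm_div, Complex.norm_real, Real.norm_eq_abs, abs_of_pos hD]
    rcases le_or_gt u 1 with h1 | h1
    · have hden : c₁ * u ≤ 1 - Real.exp (-(2 * u)) := one_sub_exp_ge hu.le h1
      calc ‖g x - g 0‖ / (1 - Real.exp (-(2 * u))) ≤ (L * u) / (c₁ * u) :=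
            div_le_div₀ (by positivity) (hlip x) (mul_pos hc1 hu) hden
        _ = L / c₁ := by field_simp
        _ ≤ (L + 2 * G) / c₁ := by gcongr; linarith
    · have hden : c₁ ≤ 1 - Real.exp (-(2 * u)) := by
        simp only [hc₁]; linarith [Real.exp_le_exp.2 (by linarith : -(2 * u) ≤ -2)]
      have hnum : ‖g x - g 0‖ ≤ 2 * G := (norm_sub_le _ _).trans (by linarith [hG x, hG 0])
      calc ‖g x - g 0‖ / (1 - Real.exp (-(2 * u))) ≤ (2 * G) / c₁ :=
            div_le_div₀ (by positivity) hnum hc1 hden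
        _ ≤ (L + 2 * G) / c₁ := by gcongr; linarith
  have hT2 : ‖g 0 * ((1 / (1 - Real.exp (-(2 * u))) - 1 / (2 * u) : ℝ) : ℂ)‖ ≤ ‖g 0‖ * H := by
    rw [norm_mul, Complex.norm_real, Real.norm_eq_abs]
    exact mul_le_mul_of_nonneg_left (abs_inv_sub_inv_le hu) (norm_nonneg _)
  have hexp : Real.exp (-((a + 1 / 2) * u)) ≤ Real.exp (-(u / 2)) :=
    Real.exp_le_exp.2 (by nlinarith [(Nat.cast_nonneg a : (0 : ℝ) ≤ a)])
  have hsplit : weilPFRegular a g x = (Real.exp (-((a + 1 / 2) * u)) : ℂ) *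
      ((g x - g 0) / ((1 - Real.exp (-(2 * u)) : ℝ) : ℂ) +
        g 0 * ((1 / (1 - Real.exp (-(2 * u))) - 1 / (2 * u) : ℝ) : ℂ)) := by
    simp only [weilPFRegular, ← hu_def]
    have h2u : ((2 * u : ℝ) : ℂ) ≠ 0 := by exact_mod_cast (by positivity : (2 * u : ℝ) ≠ 0)
    have hDc : ((1 - Real.exp (-(2 * u)) : ℝ) : ℂ) ≠ 0 := by exact_mod_cast hD.ne'
    push_cast
    field_simp
    ring
  rw [hsplit, norm_mul, Complex.norm_real, Real.norm_eq_abs, abs_of_pos (Real.exp_pos _), mul_comm]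
  refine mul_le_mul ((norm_add_le _ _).trans (add_le_add hT1 hT2)) hexp (Real.exp_pos _).le
    (by positivity)

/-- `e^{−u/2} ≤ 16/(1 + u²)` for `u ≥ 0` (from `1 + y ≤ e^y` twice). [folklore] -/
private theorem exp_neg_half_le {u : ℝ} (hu : 0 ≤ u) : Real.exp (-(u / 2)) ≤ 16 / (1 + u ^ 2) := by
  have h1 : 1 + u / 4 ≤ Real.exp (u / 4) := by linarith [Real.add_one_le_exp (u / 4)]
  have h2 : (1 + u / 4) ^ 2 ≤ Real.exp (u / 2) := by
    calc (1 + u / 4) ^ 2 ≤ Real.exp (u / 4) ^ 2 := by gcongr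
      _ = Real.exp (u / 2) := by rw [← Real.exp_nat_mul]; ring_nf
  have h3 : 1 + u ^ 2 ≤ 16 * Real.exp (u / 2) := by nlinarith
  rw [Real.exp_neg, inv_eq_one_div, div_le_div_iff₀ (Real.exp_pos _) (by positivity)]
  linarith

/-- Measurability of the regular part. [folklore] -/
private theorem aestronglyMeasurable_weilPFRegular (hg : IsWeilTest g) (a : ℕ) :
    AEStronglyMeasurable (weilPFRegular a g) volume := by
  have hgm : Measurable g := hg.1.continuous.measurable
  unfold weilPFRegular
  refine Measurable.aestronglyMeasurable ?_
  refine Measurable.mul (by fun_prop) (Measurable.sub (hgm.div (by fun_prop)) (measurable_const.div (by fun_prop)))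

/-- **The regular part is integrable** for a test function (so Weil's `PF` is an honest integral plus
a logarithm, p. 260). [cite: Weil1952FormulesExplicites, p. 260 (PF)] -/
theorem integrable_weilPFRegular (hg : IsWeilTest g) (a : ℕ) : Integrable (weilPFRegular a g) := by
  obtain ⟨M, hM0, hM⟩ := exists_norm_weilPFRegular_le hg a
  refine Integrable.mono' ((integrable_inv_one_add_sq.const_mul (M * 16)))
    (aestronglyMeasurable_weilPFRegular hg a) (Eventually.of_forall fun x ↦ ?_)
  calc ‖weilPFRegular a g x‖ ≤ M * Real.exp (-(|x| / 2)) := hM x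
    _ ≤ M * (16 / (1 + |x| ^ 2)) := mul_le_mul_of_nonneg_left (exp_neg_half_le (abs_nonneg x)) hM0
    _ = M * 16 * (1 + x ^ 2)⁻¹ := by rw [sq_abs]; ring

/-! ### The counterterm: an exponential Frullani integral -/

/-- `∫_ℝ (1 − e^{−λ|x|}) e^{−β|x|}/(2|x|) dx = log((β + λ)/β)` for `β, λ > 0` (fold `x ↦ |x|`,
then `∫₀^∞ (e^{−βt} − e^{−(β+λ)t}) dt/t = log((β+λ)/β)`; this is the `log λ` of Weil's
regularisation, p. 260). [cite: Weil1952FormulesExplicites, p. 260 (PF, the term 2β(0) log λ)] -/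
theorem integral_counterterm {β lam : ℝ} (hβ : 0 < β) (hlam : 0 < lam) :
    ∫ x : ℝ, (1 - Real.exp (-lam * |x|)) * Real.exp (-(β * |x|)) / (2 * |x|) =
      Real.log ((β + lam) / β) := by
  have e : ∀ x : ℝ, (1 - Real.exp (-lam * |x|)) * Real.exp (-(β * |x|)) / (2 * |x|) =
      (fun t : ℝ ↦ (Real.exp (-(β * t)) - Real.exp (-((β + lam) * t))) / t / 2) |x| := by
    intro x
    simp only
    rw [sub_mul, one_mul, ← Real.exp_add, show -lam * |x| + -(β * |x|) = -((β + lam) * |x|) by ring]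
    ring
  simp_rw [e]
  rw [integral_comp_abs (f := fun t : ℝ ↦ (Real.exp (-(β * t)) - Real.exp (-((β + lam) * t))) / t / 2)]
  have h := Literature.Analysis.SpecialFunctions.integral_frullani_exp hβ (by linarith : 0 < β + lam)
  rw [show (fun t : ℝ ↦ (Real.exp (-(β * t)) - Real.exp (-((β + lam) * t))) / t / 2) =
      fun t : ℝ ↦ (1 / 2) * ((Real.exp (-(β * t)) - Real.exp (-((β + lam) * t))) / t) by
      funext t; ring, integral_const_mul, h]
  ring

/-- The counterterm is integrable on `ℝ` (`β, λ > 0`). [cite: Weil1952FormulesExplicites, p. 260 (PF)] -/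
theorem integrable_counterterm {β lam : ℝ} (hβ : 0 < β) (hlam : 0 < lam) :
    Integrable fun x : ℝ ↦ (1 - Real.exp (-lam * |x|)) * Real.exp (-(β * |x|)) / (2 * |x|) := by
  -- integrability of the real Frullani kernel on `(0, ∞)`
  have hK : IntegrableOn (fun t : ℝ ↦ (Real.exp (-(β * t)) - Real.exp (-((β + lam) * t))) / t / 2)
      (Ioi 0) := by
    have h0 : IntegrableOn (Literature.Analysis.SpecialFunctions.frullaniKernel (β : ℂ) ((β + lam : ℝ) : ℂ))
        (Ioi 0) :=
      Literature.Analysis.SpecialFunctions.integrableOn_frullaniKernel (by simpa using hβ)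
        (by simp only [Complex.ofReal_re]; linarith)
    have h1 : IntegrableOn (fun t : ℝ ↦
        (Literature.Analysis.SpecialFunctions.frullaniKernel (β : ℂ) ((β + lam : ℝ) : ℂ) t).re / 2)
        (Ioi 0) := h0.re.div_const 2
    refine h1.congr_fun (fun t _ ↦ ?_) measurableSet_Ioi
    have e : Literature.Analysis.SpecialFunctions.frullaniKernel (β : ℂ) ((β + lam : ℝ) : ℂ) t =
        (((Real.exp (-(β * t)) - Real.exp (-((β + lam) * t))) / t : ℝ) : ℂ) := by
      simp only [Literature.Analysis.SpecialFunctions.frullaniKernel, Complex.ofReal_div,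
        Complex.ofReal_sub, Complex.ofReal_exp, Complex.ofReal_neg, Complex.ofReal_mul,
        Complex.ofReal_add]
    simp only [e, Complex.ofReal_re]
  -- fold
  have e : (fun x : ℝ ↦ (1 - Real.exp (-lam * |x|)) * Real.exp (-(β * |x|)) / (2 * |x|)) =
      fun x : ℝ ↦ (fun t : ℝ ↦ (Real.exp (-(β * t)) - Real.exp (-((β + lam) * t))) / t / 2) |x| := by
    funext x
    simp only
    rw [sub_mul, one_mul, ← Real.exp_add, show -lam * |x| + -(β * |x|) = -((β + lam) * |x|) by ring]
    ring
  rw [e]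
  -- `x ↦ f |x|` is integrable on `ℝ` iff `f` is integrable on `(0, ∞)`
  have hIoi : IntegrableOn (fun x : ℝ ↦ (fun t : ℝ ↦ (Real.exp (-(β * t)) -
      Real.exp (-((β + lam) * t))) / t / 2) |x|) (Ioi 0) :=
    hK.congr_fun (fun x hx ↦ by simp only [abs_of_pos (mem_Ioi.1 hx)]) measurableSet_Ioi
  have hIic : IntegrableOn (fun x : ℝ ↦ (fun t : ℝ ↦ (Real.exp (-(β * t)) -
      Real.exp (-((β + lam) * t))) / t / 2) |x|) (Iic 0) := by
    rw [← Measure.map_neg_eq_self (volume : Measure ℝ)]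
    let m : MeasurableEmbedding fun x : ℝ ↦ -x := (Homeomorph.neg ℝ).measurableEmbedding
    rw [m.integrableOn_map_iff]
    simp_rw [Function.comp_def, abs_neg, neg_preimage, neg_Iic, neg_zero]
    exact Iff.mpr integrableOn_Ici_iff_integrableOn_Ioi hIoi
  have := hIic.union hIoi
  rwa [Iic_union_Ioi, integrableOn_univ] at this

/-! ### The finite part -/

/-- Pointwise decomposition of the regularised integrand:
`(1 − e^{−λ|x|}) g(x) K_{1,a}(x) = (1 − e^{−λ|x|}) R_a(g)(x) + g(0) (1 − e^{−λ|x|}) e^{−β|x|}/(2|x|)`,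
`β = a + 1/2`. [folklore] -/
private theorem integrand_decomp (a : ℕ) (g : ℝ → ℂ) (lam x : ℝ) :
    ((1 - Real.exp (-lam * |x|) : ℝ) : ℂ) * (g x * (weilKernelK1 a x : ℂ)) =
      ((1 - Real.exp (-lam * |x|) : ℝ) : ℂ) * weilPFRegular a g x +
        g 0 * (((1 - Real.exp (-lam * |x|)) * Real.exp (-(((a : ℝ) + 1 / 2) * |x|)) / (2 * |x|) : ℝ) : ℂ) := by
  rw [weilKernelK1_eq]
  rcases eq_or_ne x 0 with rfl | hx
  · simp [weilPFRegular]
  have hu : 0 < |x| := abs_pos.2 hx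
  have hD : (1 - Real.exp (-(2 * |x|)) : ℝ) ≠ 0 := by
    have : Real.exp (-(2 * |x|)) < 1 := Real.exp_lt_one_iff.2 (by linarith)
    linarith
  have hDc : ((1 - Real.exp (-(2 * |x|)) : ℝ) : ℂ) ≠ 0 := by exact_mod_cast hD
  have h2 : ((2 * |x| : ℝ) : ℂ) ≠ 0 := by exact_mod_cast (by positivity : (2 * |x| : ℝ) ≠ 0)
  simp only [weilPFRegular]
  push_cast
  field_simp
  ring

/-- **Weil's finite part of `∫ g K_{1,a}` exists for test functions and equals
`∫ R_a(g) − g(0) log(a + 1/2)`**: the regularised expressions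
`∫ (1 − e^{−λ|x|}) g(x) K_{1,a}(x) dx − g(0) log λ` converge, as `λ → +∞`, to
`∫_ℝ e^{−(a+1/2)|x|}(g(x)/(1 − e^{−2|x|}) − g(0)/(2|x|)) dx − g(0) log(a + 1/2)`.
[cite: Weil1952FormulesExplicites, p. 260 (definition and existence of PF), p. 262 (K_{1,f})] -/
theorem tendsto_weilPF (hg : IsWeilTest g) (a : ℕ) :
    Tendsto (fun lam : ℝ ↦ (∫ x : ℝ, ((1 - Real.exp (-lam * |x|) : ℝ) : ℂ) *
        (g x * (weilKernelK1 a x : ℂ))) - g 0 * (Real.log lam : ℂ)) atTop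
      (𝓝 ((∫ x : ℝ, weilPFRegular a g x) - g 0 * (Real.log ((a : ℝ) + 1 / 2) : ℂ))) := by
  set β : ℝ := (a : ℝ) + 1 / 2 with hβ
  have hβ0 : 0 < β := by positivity
  have hreg := integrable_weilPFRegular hg a
  -- (1) dominated convergence for the regular part
  have hDCT : Tendsto (fun lam : ℝ ↦ ∫ x : ℝ, ((1 - Real.exp (-lam * |x|) : ℝ) : ℂ) * weilPFRegular a g x)
      atTop (𝓝 (∫ x : ℝ, weilPFRegular a g x)) := by
    refine tendsto_integral_filter_of_dominated_convergence (fun x ↦ ‖weilPFRegular a g x‖) ?_ ?_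
      hreg.norm ?_
    · exact Eventually.of_forall fun lam ↦
        (Continuous.aestronglyMeasurable (by fun_prop)).mul hreg.aestronglyMeasurable
    · filter_upwards [eventually_ge_atTop (0 : ℝ)] with lam hlam
      refine Eventually.of_forall fun x ↦ ?_
      rw [norm_mul, Complex.norm_real, Real.norm_eq_abs]
      refine mul_le_of_le_one_left (norm_nonneg _) ?_
      have h1 : 0 ≤ Real.exp (-lam * |x|) := (Real.exp_pos _).le
      have h2 : Real.exp (-lam * |x|) ≤ 1 := Real.exp_le_one_iff.2 (by nlinarith [abs_nonneg x])
      rw [abs_of_nonneg (by linarith)]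
      linarith
    · refine Eventually.of_forall fun x ↦ ?_
      rcases eq_or_ne x 0 with rfl | hx
      · simp [weilPFRegular_zero]
      · have hx' : 0 < |x| := abs_pos.2 hx
        have h0 : Tendsto (fun lam : ℝ ↦ lam * |x|) atTop atTop := tendsto_id.atTop_mul_const hx'
        have h0' : Tendsto (fun lam : ℝ ↦ -lam * |x|) atTop atBot := by
          refine (tendsto_neg_atTop_atBot.comp h0).congr fun lam ↦ ?_
          simp [neg_mul]
        have h1 : Tendsto (fun lam : ℝ ↦ Real.exp (-lam * |x|)) atTop (𝓝 0) :=
          Real.tendsto_exp_atBot.comp h0'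
        have h2 : Tendsto (fun lam : ℝ ↦ ((1 - Real.exp (-lam * |x|) : ℝ) : ℂ)) atTop (𝓝 ((1 - 0 : ℝ) : ℂ)) :=
          (Complex.continuous_ofReal.tendsto _).comp (tendsto_const_nhds.sub h1)
        simpa using h2.mul_const (weilPFRegular a g x)
  -- (2) the counterterm: `g(0) (log((β+λ)/β) − log λ) → −g(0) log β`
  have hlog : Tendsto (fun lam : ℝ ↦ Real.log ((β + lam) / β) - Real.log lam) atTop
      (𝓝 (-Real.log β)) := by
    have h1 : Tendsto (fun lam : ℝ ↦ lam⁻¹ + β⁻¹) atTop (𝓝 (0 + β⁻¹)) :=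
      tendsto_inv_atTop_zero.add tendsto_const_nhds
    have h2 : Tendsto (fun lam : ℝ ↦ Real.log (lam⁻¹ + β⁻¹)) atTop (𝓝 (Real.log (0 + β⁻¹))) :=
      (Real.continuousAt_log (by simp [hβ0.ne'])).tendsto.comp h1
    rw [zero_add, Real.log_inv] at h2
    refine h2.congr' ?_
    filter_upwards [eventually_gt_atTop (0 : ℝ)] with lam hlam
    rw [← Real.log_div (by positivity) hlam.ne']
    congr 1
    field_simp
  -- (3) assemble
  have hmain : Tendsto (fun lam : ℝ ↦ (∫ x : ℝ, ((1 - Real.exp (-lam * |x|) : ℝ) : ℂ) * weilPFRegular a g x) +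
      g 0 * ((Real.log ((β + lam) / β) - Real.log lam : ℝ) : ℂ)) atTop
      (𝓝 ((∫ x : ℝ, weilPFRegular a g x) + g 0 * ((-Real.log β : ℝ) : ℂ))) :=
    hDCT.add (((Complex.continuous_ofReal.tendsto _).comp hlog).const_mul (g 0))
  have hlim_eq : (∫ x : ℝ, weilPFRegular a g x) + g 0 * ((-Real.log β : ℝ) : ℂ) =
      (∫ x : ℝ, weilPFRegular a g x) - g 0 * (Real.log ((a : ℝ) + 1 / 2) : ℂ) := by
    push_cast; ring
  rw [← hlim_eq]
  refine hmain.congr' ?_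
  filter_upwards [eventually_gt_atTop (0 : ℝ)] with lam hlam
  have hct := integral_counterterm hβ0 hlam
  have hcti := integrable_counterterm hβ0 hlam
  have hcti' : Integrable fun x : ℝ ↦
      g 0 * (((1 - Real.exp (-lam * |x|)) * Real.exp (-(β * |x|)) / (2 * |x|) : ℝ) : ℂ) :=
    (hcti.ofReal (𝕜 := ℂ)).const_mul (g 0)
  have hri : Integrable fun x : ℝ ↦ ((1 - Real.exp (-lam * |x|) : ℝ) : ℂ) * weilPFRegular a g x := by
    refine hreg.bdd_mul (c := 1) (Continuous.aestronglyMeasurable (by fun_prop)) (Eventually.of_forall fun x ↦ ?_)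
    rw [Complex.norm_real, Real.norm_eq_abs]
    have h1 : 0 ≤ Real.exp (-lam * |x|) := (Real.exp_pos _).le
    have h2 : Real.exp (-lam * |x|) ≤ 1 := Real.exp_le_one_iff.2 (by nlinarith [abs_nonneg x])
    rw [abs_of_nonneg (by linarith)]
    linarith
  calc (∫ x : ℝ, ((1 - Real.exp (-lam * |x|) : ℝ) : ℂ) * weilPFRegular a g x) +
        g 0 * ((Real.log ((β + lam) / β) - Real.log lam : ℝ) : ℂ)
      = (∫ x : ℝ, ((1 - Real.exp (-lam * |x|) : ℝ) : ℂ) * weilPFRegular a g x) +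
          g 0 * (((∫ x : ℝ, (1 - Real.exp (-lam * |x|)) * Real.exp (-(β * |x|)) / (2 * |x|)) : ℝ) : ℂ) -
          g 0 * (Real.log lam : ℂ) := by rw [hct]; push_cast; ring
    _ = (∫ x : ℝ, (((1 - Real.exp (-lam * |x|) : ℝ) : ℂ) * weilPFRegular a g x +
          g 0 * (((1 - Real.exp (-lam * |x|)) * Real.exp (-(β * |x|)) / (2 * |x|) : ℝ) : ℂ))) -
          g 0 * (Real.log lam : ℂ) := by
        rw [integral_add hri hcti', integral_const_mul, integral_complex_ofReal]
    _ = (∫ x : ℝ, ((1 - Real.exp (-lam * |x|) : ℝ) : ℂ) * (g x * (weilKernelK1 a x : ℂ))) -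
          g 0 * (Real.log lam : ℂ) := by
        congr 1
        refine integral_congr_ae (Eventually.of_forall fun x ↦ ?_)
        exact (integrand_decomp a g lam x).symm

/-- **Closed form of Weil's finite part for test functions**:
`PF ∫ g(x) K_{1,a}(x) dx = ∫_ℝ e^{−(a+1/2)|x|}(g(x)/(1 − e^{−2|x|}) − g(0)/(2|x|)) dx − g(0) log(a + 1/2)`
(`weilPFIntegralK1 a g`, the `limUnder` of `WeilExplicitDirichletWeilForm.lean`, is a genuine limit).
[cite: Weil1952FormulesExplicites, p. 260 (PF), p. 262 (K_{1,f})] -/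
theorem weilPFIntegralK1_eq (hg : IsWeilTest g) (a : ℕ) :
    weilPFIntegralK1 a g =
      (∫ x : ℝ, weilPFRegular a g x) - g 0 * (Real.log ((a : ℝ) + 1 / 2) : ℂ) := by
  unfold weilPFIntegralK1
  exact (tendsto_weilPF hg a).limUnder_eq

end WeilPF

end Literature.NumberTheory.LFunctions

end
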